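import Literature.MathematicalPhysics.QuantumLattice.TorusOutwardNeighbours
import Literature.MathematicalPhysics.QuantumLattice.LatticeToriProofs
import Mathlib.NumberTheory.Harmonic.Bounds
import Mathlib.Analysis.SpecialFunctions.Trigonometric.DerivHyp
import HarnessLib

/-!
# The truncated logarithmic dipole on `(ℤ/Lℤ)²` for a general finite-range hopping graph

Trunk T-QLATTICE (family `hubbard`; consumers: the sharp-exponent Koma–Tasaki bounds for the
`t–t'` Hubbard model, `Summits/HubbardSuperconductivity/HubbardLadder/Bounds/PairCorrelationEtaLineDipoleTPrime.lean`;
`TorusLogDipole.lean` is the nearest-neighbour special case).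

Koma–Tasaki (PRL 68 (1992) 3248, proof of eq. (13), following McBryan–Spencer, CMP 53 (1977) 299)
optimise their complex-gauge bound with a dipole potential having P1 `φ_x - φ_y ≈ (q/π) log|x-y|`
(gain) and P2 `Σ_{bonds} |∇φ|² ≈ (q²/π) log|x-y|` (energy); their note 9 records that the argument
covers any finite-range hopping. This file makes the `ℓ^∞` dipole an explicit definition and bounds
its energy on ANY symmetric, translation-invariant graph `Γ` on the torus whose bonds have
`ℓ^∞`-length `≤ 1`, through ONE combinatorial datum: the number
`N_s(Γ) = Σ_{‖z‖=s} #{w : z ∼_Γ w, ‖w‖ = s+1}` of outward bonds between consecutive `ℓ^∞`-shells.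

* `logDipole x y q ρ` — `u ↦ q H(min(dist(u,y), ρ)) - q H(min(dist(u,x), ρ))` (`H` = harmonic numbers);
* `logDipole_gain` — for `2ρ + 1 ≤ dist(x,y)`: `φ_x - φ_y = 2q H(ρ)`;
* `logMonopole_energy_le_of_graph` — if `N_s(Γ) ≤ A(s+1)` for all `s`, the monopole
  `u ↦ q H(min(dist(u,y), ρ))` has `Σ_u Σ_v [u ∼_Γ v] (cosh(φ_u - φ_v) - 1) ≤ A q² e^{q²/2} H(ρ)`;
* `logDipole_energy_le_of_graph` — the dipole then has `Γ`-energy `≤ 2A q² e^{q²/2} H(ρ)`;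
* `logDipole_energy_torusGraph_le` — nearest-neighbour torus graph: `A = 8` (`N_s ≤ 8s+4`,
  `TorusOutwardNeighbours.sum_card_outward_le`), energy `≤ 16 q² e^{q²/2} H(ρ)`.

The diagonal (next-nearest-neighbour) graph of the `t–t'` model has `A = 16`
(`TorusDiagOutwardNeighbours.lean`). Sources: T. Koma, H. Tasaki, PRL 68 (1992) 3248, proof of
eq. (13) and note 9; O. A. McBryan, T. Spencer, Commun. Math. Phys. 53 (1977) 299. Mathlib has
`harmonic`, `Real.cosh_le_exp_half_sq`, `Finset.sum_fiberwise_of_maps_to`, `Equiv.subRight`, and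
no discrete potential theory; torus geometry is the tree's (`LatticeToriProofs`, `TorusOutwardNeighbours`).
-/
noncomputable section

namespace Literature.MathematicalPhysics.QuantumLattice

open Finset Literature.Probability.LatticeModels

/-! ### Two elementary inequalities -/

/-- `cosh s - 1 ≤ (s²/2) e^{s²/2}` (from `cosh s ≤ e^{s²/2}` and `e^u - 1 ≤ u e^u`). [folklore] -/
private theorem cosh_sub_one_le_half_sq_mul_exp' (s : ℝ) :
    Real.cosh s - 1 ≤ s ^ 2 / 2 * Real.exp (s ^ 2 / 2) := by
  have h1 : Real.cosh s ≤ Real.exp (s ^ 2 / 2) := Real.cosh_le_exp_half_sq s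
  have h2 : 1 - s ^ 2 / 2 ≤ Real.exp (-(s ^ 2 / 2)) := by
    have := Real.add_one_le_exp (-(s ^ 2 / 2)); linarith
  have h3 : Real.exp (s ^ 2 / 2) * (1 - s ^ 2 / 2) ≤ 1 := by
    have := mul_le_mul_of_nonneg_left h2 (Real.exp_pos (s ^ 2 / 2)).le
    rwa [← Real.exp_add, add_neg_cancel, Real.exp_zero] at this
  have h4 : Real.exp (s ^ 2 / 2) * (1 - s ^ 2 / 2) =
      Real.exp (s ^ 2 / 2) - s ^ 2 / 2 * Real.exp (s ^ 2 / 2) := by ring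
  linarith

/-- The shell weight of the logarithmic potential against `A(s+1)` outward bonds:
`A(s+1)(cosh(q/(s+1)) - 1) ≤ (A/2) q² e^{q²/2}/(s+1)`. [folklore] -/
private theorem shell_weight_le' (A : ℕ) (q : ℝ) (s : ℕ) :
    ((A : ℝ) * ((s : ℝ) + 1)) * (Real.cosh (q * ((s : ℝ) + 1)⁻¹) - 1) ≤
      (A : ℝ) / 2 * (q ^ 2 * Real.exp (q ^ 2 / 2)) * ((s : ℝ) + 1)⁻¹ := by
  have hs : (0 : ℝ) < (s : ℝ) + 1 := by positivity
  have hr2eq : (q * ((s : ℝ) + 1)⁻¹) ^ 2 = q ^ 2 * (((s : ℝ) + 1) ^ 2)⁻¹ := by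
    rw [mul_pow, inv_pow]
  have hr2 : (q * ((s : ℝ) + 1)⁻¹) ^ 2 ≤ q ^ 2 := by
    rw [hr2eq]
    calc q ^ 2 * (((s : ℝ) + 1) ^ 2)⁻¹ ≤ q ^ 2 * 1 := by
          refine mul_le_mul_of_nonneg_left ?_ (sq_nonneg q)
          rw [inv_le_one_iff₀]
          right
          nlinarith [show (0 : ℝ) ≤ (s : ℝ) from Nat.cast_nonneg s]
      _ = q ^ 2 := mul_one _
  have he : Real.cosh (q * ((s : ℝ) + 1)⁻¹) - 1 ≤
      (q * ((s : ℝ) + 1)⁻¹) ^ 2 / 2 * Real.exp (q ^ 2 / 2) :=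
    (cosh_sub_one_le_half_sq_mul_exp' _).trans
      (mul_le_mul_of_nonneg_left (Real.exp_le_exp.2 (by linarith)) (by positivity))
  calc ((A : ℝ) * ((s : ℝ) + 1)) * (Real.cosh (q * ((s : ℝ) + 1)⁻¹) - 1)
      ≤ ((A : ℝ) * ((s : ℝ) + 1)) * ((q * ((s : ℝ) + 1)⁻¹) ^ 2 / 2 * Real.exp (q ^ 2 / 2)) :=
        mul_le_mul_of_nonneg_left he (by positivity)
    _ = (A : ℝ) / 2 * (q ^ 2 * Real.exp (q ^ 2 / 2)) * ((s : ℝ) + 1)⁻¹ := by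
        rw [hr2eq]
        field_simp

/-- `Σ_{s<ρ} 1/(s+1) = H(ρ)` over `ℝ`. [folklore] -/
private theorem sum_range_inv_eq_harmonic' (ρ : ℕ) :
    ∑ s ∈ Finset.range ρ, ((s : ℝ) + 1)⁻¹ = (harmonic ρ : ℝ) := by
  induction ρ with
  | zero => simp
  | succ n ih =>
      rw [Finset.sum_range_succ, ih, harmonic_succ]
      push_cast
      ring

variable {L : ℕ} [NeZero L]

/-! ### Bonds of `ℓ^∞`-length at most one -/

/-- Along a bond of `ℓ^∞`-length `≤ 1` the truncated distances to any centre differ by at most `1`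
(triangle inequality for the torus distance). Friedli–Velenik (2017), §3.1.
[cite: FriedliVelenikSMLS2017, §3.1] -/
theorem min_torusDist_le_of_torusDist_le_one {u v : TorusSite 2 L} (h : torusDist u v ≤ 1)
    (y : TorusSite 2 L) (ρ : ℕ) :
    min (torusDist u y) ρ ≤ min (torusDist v y) ρ + 1 ∧
      min (torusDist v y) ρ ≤ min (torusDist u y) ρ + 1 ∧
      torusDist u y ≤ torusDist v y + 1 ∧ torusDist v y ≤ torusDist u y + 1 := by
  have h1 : torusDist u y ≤ torusDist u v + torusDist v y := torusDist_triangle' u v y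
  have h2 : torusDist v y ≤ torusDist v u + torusDist u y := torusDist_triangle' v u y
  rw [torusDist_comm' v u] at h2
  refine ⟨?_, ?_, ?_, ?_⟩ <;> omega

/-! ### The truncated logarithmic monopole on a general graph -/

/-- **Energy of the truncated logarithmic monopole on a finite-range graph.** Let `Γ` be a
symmetric graph on `(ℤ/Lℤ)²` which is translation invariant, whose bonds have `ℓ^∞`-length `≤ 1`,
and whose number of outward bonds between the shells `‖z‖ = s` and `‖w‖ = s+1` is at most
`A(s+1)` for every `s`. Then for every centre `y`, radius `ρ` and charge `q`, the potential
`φ(u) = q H(min(dist(u,y), ρ))` has `Σ_u Σ_v [u ∼_Γ v] (cosh(φ_u - φ_v) - 1) ≤ A q² e^{q²/2} H(ρ)`,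
uniformly in `L`. Koma–Tasaki, PRL 68 (1992) 3248, proof of eq. (13) (P1–P2), note 9 (finite
range); `ℓ^∞` version, McBryan–Spencer 1977. [cite: KomaTasakiPRL1992, proof of eq. (13) (P1–P2) and note 9] -/
theorem logMonopole_energy_le_of_graph (Γ : SimpleGraph (TorusSite 2 L)) [DecidableRel Γ.Adj]
    (A : ℕ) (hΓd : ∀ u v, Γ.Adj u v → torusDist u v ≤ 1)
    (hΓt : ∀ u v c, Γ.Adj (u - c) (v - c) ↔ Γ.Adj u v)
    (hΓc : ∀ s : ℕ, ∑ z ∈ univ.filter (fun z : TorusSite 2 L => torusNorm z = s),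
        #{w : TorusSite 2 L | Γ.Adj z w ∧ torusNorm w = s + 1} ≤ A * (s + 1))
    (y : TorusSite 2 L) (ρ : ℕ) (q : ℝ) :
    ∑ u : TorusSite 2 L, ∑ v : TorusSite 2 L,
        (if Γ.Adj u v then
          (Real.cosh (q * (harmonic (min (torusDist u y) ρ) : ℝ) -
              q * (harmonic (min (torusDist v y) ρ) : ℝ)) - 1)
        else 0) ≤ (A : ℝ) * (q ^ 2 * Real.exp (q ^ 2 / 2)) * (harmonic ρ : ℝ) := by
  classical
  -- shell weights and the directed (outward) bond weight
  set e : ℕ → ℝ := fun m => Real.cosh (q * ((m : ℝ) + 1)⁻¹) - 1 with he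
  have he0 : ∀ m, 0 ≤ e m := fun m => sub_nonneg.2 (Real.one_le_cosh _)
  set g : TorusSite 2 L → TorusSite 2 L → ℝ := fun u v =>
    if min (torusDist v y) ρ = min (torusDist u y) ρ + 1 then e (min (torusDist u y) ρ) else 0
    with hg
  have hharm : ∀ m : ℕ, (harmonic (m + 1) : ℝ) - (harmonic m : ℝ) = ((m : ℝ) + 1)⁻¹ := by
    intro m
    rw [harmonic_succ]
    push_cast
    ring
  -- (1) along a bond the `cosh - 1` term is the outward weight in one of the two directions
  have hedge : ∀ u v, Γ.Adj u v →
      Real.cosh (q * (harmonic (min (torusDist u y) ρ) : ℝ) -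
          q * (harmonic (min (torusDist v y) ρ) : ℝ)) - 1 = g u v + g v u := by
    intro u v huv
    have hlip := min_torusDist_le_of_torusDist_le_one (hΓd u v huv) y ρ
    rcases Nat.lt_trichotomy (min (torusDist u y) ρ) (min (torusDist v y) ρ) with h | h | h
    · have h' : min (torusDist v y) ρ = min (torusDist u y) ρ + 1 := by omega
      have hne : ¬ min (torusDist u y) ρ = min (torusDist v y) ρ + 1 := by omega
      simp only [hg, if_pos h', if_neg hne, add_zero]
      rw [h', ← mul_sub, show (harmonic (min (torusDist u y) ρ) : ℝ) -
          (harmonic (min (torusDist u y) ρ + 1) : ℝ) = -(((min (torusDist u y) ρ : ℕ) : ℝ) + 1)⁻¹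
        by rw [← hharm]; ring, mul_neg, Real.cosh_neg]
    · have h1 : ¬ min (torusDist v y) ρ = min (torusDist u y) ρ + 1 := by omega
      have h2 : ¬ min (torusDist u y) ρ = min (torusDist v y) ρ + 1 := by omega
      simp only [hg, if_neg h1, if_neg h2, add_zero]
      rw [h, sub_self, Real.cosh_zero, sub_self]
    · have h' : min (torusDist u y) ρ = min (torusDist v y) ρ + 1 := by omega
      have hne : ¬ min (torusDist v y) ρ = min (torusDist u y) ρ + 1 := by omega
      simp only [hg, if_pos h', if_neg hne, zero_add]
      rw [h', ← mul_sub, hharm]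
  -- (2) symmetrise
  have hsum : (∑ u : TorusSite 2 L, ∑ v : TorusSite 2 L,
      (if Γ.Adj u v then
        (Real.cosh (q * (harmonic (min (torusDist u y) ρ) : ℝ) -
            q * (harmonic (min (torusDist v y) ρ) : ℝ)) - 1)
      else 0)) =
      2 * ∑ u : TorusSite 2 L, ∑ v : TorusSite 2 L, (if Γ.Adj u v then g u v else 0) := by
    have hsplit : ∀ u v : TorusSite 2 L,
        (if Γ.Adj u v then
          (Real.cosh (q * (harmonic (min (torusDist u y) ρ) : ℝ) -
              q * (harmonic (min (torusDist v y) ρ) : ℝ)) - 1)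
        else 0) =
        (if Γ.Adj u v then g u v else 0) + (if Γ.Adj v u then g v u else 0) := by
      intro u v
      by_cases huv : Γ.Adj u v
      · rw [if_pos huv, if_pos huv, if_pos (Γ.adj_symm huv), hedge u v huv]
      · rw [if_neg huv, if_neg huv, if_neg (fun h => huv (Γ.adj_symm h)), add_zero]
    simp only [hsplit, sum_add_distrib]
    rw [sum_comm (f := fun u v => if Γ.Adj v u then g v u else 0), two_mul]
  rw [hsum]
  -- (3) at each site: outward weight × number of outward bonds, and only for `dist(u,y) < ρ`
  have hinner : ∀ u : TorusSite 2 L,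
      ∑ v : TorusSite 2 L, (if Γ.Adj u v then g u v else 0) ≤
        (if torusDist u y < ρ then e (torusDist u y) else 0) *
          (#{v : TorusSite 2 L | Γ.Adj u v ∧ torusDist v y = torusDist u y + 1} : ℝ) := by
    intro u
    by_cases hu : torusDist u y < ρ
    · rw [if_pos hu]
      have hmu : min (torusDist u y) ρ = torusDist u y := min_eq_left hu.le
      calc ∑ v : TorusSite 2 L, (if Γ.Adj u v then g u v else 0)
          ≤ ∑ v : TorusSite 2 L, (if Γ.Adj u v ∧
              torusDist v y = torusDist u y + 1 then e (torusDist u y) else 0) := by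
            refine sum_le_sum fun v _ => ?_
            by_cases huv : Γ.Adj u v
            · rw [if_pos huv]
              simp only [hg]
              by_cases hv : min (torusDist v y) ρ = min (torusDist u y) ρ + 1
              · have hd := (min_torusDist_le_of_torusDist_le_one (hΓd u v huv) y ρ).2.2
                have hdv : torusDist v y = torusDist u y + 1 := by omega
                rw [if_pos hv, if_pos ⟨huv, hdv⟩, hmu]
              · rw [if_neg hv]
                split_ifs
                · exact he0 _
                · exact le_rfl
            · rw [if_neg huv, if_neg (fun h => huv h.1)]
        _ = e (torusDist u y) * (#{v : TorusSite 2 L | Γ.Adj u v ∧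
              torusDist v y = torusDist u y + 1} : ℝ) := by
            rw [← sum_filter, sum_const, nsmul_eq_mul, mul_comm]
    · rw [if_neg hu, zero_mul]
      refine le_of_eq (sum_eq_zero fun v _ => ?_)
      split_ifs with huv
      · simp only [hg]
        rw [if_neg]
        have hlip := min_torusDist_le_of_torusDist_le_one (hΓd u v huv) y ρ
        omega
      · rfl
  -- (4) translate to the origin and sum over shells
  have htrans : (∑ u : TorusSite 2 L,
      (if torusDist u y < ρ then e (torusDist u y) else 0) *
        (#{v : TorusSite 2 L | Γ.Adj u v ∧ torusDist v y = torusDist u y + 1} : ℝ)) =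
      ∑ z : TorusSite 2 L, (if torusNorm z < ρ then e (torusNorm z) else 0) *
        (#{w : TorusSite 2 L | Γ.Adj z w ∧ torusNorm w = torusNorm z + 1} : ℝ) := by
    refine Fintype.sum_equiv (Equiv.subRight y) _ _ fun u => ?_
    simp only [Equiv.subRight_apply, torusDist]
    congr 2
    rw [card_filter, card_filter]
    refine Fintype.sum_equiv (Equiv.subRight y) _ _ fun v => ?_
    simp only [Equiv.subRight_apply, hΓt]
  have hmaps : ∀ z ∈ (univ : Finset (TorusSite 2 L)), torusNorm z ∈ range (L + 1) := by
    intro z _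
    rw [mem_range, torusNorm_two_eq_max]
    have h0 : (z 0).val < L := ZMod.val_lt _
    omega
  have hshell : ∀ s ∈ range (L + 1),
      ∑ z ∈ (univ : Finset (TorusSite 2 L)) with torusNorm z = s,
          (if torusNorm z < ρ then e (torusNorm z) else 0) *
            (#{w : TorusSite 2 L | Γ.Adj z w ∧ torusNorm w = torusNorm z + 1} : ℝ) ≤
        if s < ρ then (A : ℝ) / 2 * (q ^ 2 * Real.exp (q ^ 2 / 2)) * ((s : ℝ) + 1)⁻¹ else 0 := by
    intro s _
    have hN : (∑ z ∈ (univ : Finset (TorusSite 2 L)) with torusNorm z = s,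
        (#{w : TorusSite 2 L | Γ.Adj z w ∧ torusNorm w = s + 1} : ℝ)) ≤
        (A : ℝ) * ((s : ℝ) + 1) := by
      have := hΓc s
      exact_mod_cast this
    calc ∑ z ∈ (univ : Finset (TorusSite 2 L)) with torusNorm z = s,
          (if torusNorm z < ρ then e (torusNorm z) else 0) *
            (#{w : TorusSite 2 L | Γ.Adj z w ∧ torusNorm w = torusNorm z + 1} : ℝ)
        = ∑ z ∈ (univ : Finset (TorusSite 2 L)) with torusNorm z = s,
            (if s < ρ then e s else 0) *
              (#{w : TorusSite 2 L | Γ.Adj z w ∧ torusNorm w = s + 1} : ℝ) := by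
          refine sum_congr rfl fun z hz => ?_
          simp only [mem_filter, mem_univ, true_and] at hz
          rw [hz]
      _ = (if s < ρ then e s else 0) *
            ∑ z ∈ (univ : Finset (TorusSite 2 L)) with torusNorm z = s,
              (#{w : TorusSite 2 L | Γ.Adj z w ∧ torusNorm w = s + 1} : ℝ) := by
          rw [mul_sum]
      _ ≤ if s < ρ then (A : ℝ) / 2 * (q ^ 2 * Real.exp (q ^ 2 / 2)) * ((s : ℝ) + 1)⁻¹ else 0 := by
          split_ifs with hsρ
          · calc e s * _ ≤ e s * ((A : ℝ) * ((s : ℝ) + 1)) := mul_le_mul_of_nonneg_left hN (he0 s)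
              _ = ((A : ℝ) * ((s : ℝ) + 1)) * (Real.cosh (q * ((s : ℝ) + 1)⁻¹) - 1) := by
                  rw [mul_comm]
              _ ≤ (A : ℝ) / 2 * (q ^ 2 * Real.exp (q ^ 2 / 2)) * ((s : ℝ) + 1)⁻¹ :=
                  shell_weight_le' A q s
          · rw [zero_mul]
  have hH : ∑ s ∈ range ρ, ((s : ℝ) + 1)⁻¹ = (harmonic ρ : ℝ) := sum_range_inv_eq_harmonic' ρ
  calc 2 * ∑ u : TorusSite 2 L, ∑ v : TorusSite 2 L, (if Γ.Adj u v then g u v else 0)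
      ≤ 2 * ∑ u : TorusSite 2 L, (if torusDist u y < ρ then e (torusDist u y) else 0) *
          (#{v : TorusSite 2 L | Γ.Adj u v ∧ torusDist v y = torusDist u y + 1} : ℝ) := by
        gcongr with u
        exact hinner u
    _ = 2 * ∑ z : TorusSite 2 L, (if torusNorm z < ρ then e (torusNorm z) else 0) *
          (#{w : TorusSite 2 L | Γ.Adj z w ∧ torusNorm w = torusNorm z + 1} : ℝ) := by
        rw [htrans]
    _ = 2 * ∑ s ∈ range (L + 1), ∑ z ∈ (univ : Finset (TorusSite 2 L)) with torusNorm z = s,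
          (if torusNorm z < ρ then e (torusNorm z) else 0) *
            (#{w : TorusSite 2 L | Γ.Adj z w ∧ torusNorm w = torusNorm z + 1} : ℝ) := by
        rw [sum_fiberwise_of_maps_to hmaps]
    _ ≤ 2 * ∑ s ∈ range (L + 1),
          (if s < ρ then (A : ℝ) / 2 * (q ^ 2 * Real.exp (q ^ 2 / 2)) * ((s : ℝ) + 1)⁻¹
            else 0) := by
        gcongr with s hs
        exact hshell s hs
    _ = 2 * ∑ s ∈ (range (L + 1)).filter (fun s => s < ρ),
          (A : ℝ) / 2 * (q ^ 2 * Real.exp (q ^ 2 / 2)) * ((s : ℝ) + 1)⁻¹ := by rw [sum_filter]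
    _ ≤ 2 * ∑ s ∈ range ρ, (A : ℝ) / 2 * (q ^ 2 * Real.exp (q ^ 2 / 2)) * ((s : ℝ) + 1)⁻¹ := by
        refine mul_le_mul_of_nonneg_left (sum_le_sum_of_subset_of_nonneg (fun s hs => ?_)
          (fun s _ _ => by positivity)) (by norm_num)
        simp only [mem_filter, mem_range] at hs ⊢
        exact hs.2
    _ = (A : ℝ) * (q ^ 2 * Real.exp (q ^ 2 / 2)) * (harmonic ρ : ℝ) := by
        rw [← mul_sum, hH]
        ring

/-! ### The logarithmic dipole -/

omit [NeZero L] in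
/-- **The truncated logarithmic dipole** `φ = φ^{(y)} - φ^{(x)}` on `(ℤ/Lℤ)²`,
`φ^{(c)}(u) = q H(min(dist(u,c), ρ))` (`H` = harmonic numbers, `dist` = periodic `ℓ^∞` distance):
the `ℓ^∞` version of the dipole potential of Koma–Tasaki's proof of their eq. (13) (McBryan–Spencer
1977), with charge `q` and truncation radius `ρ`. [cite: KomaTasakiPRL1992, proof of eq. (13) (P1–P2)] -/
def logDipole (x y : TorusSite 2 L) (q : ℝ) (ρ : ℕ) : TorusSite 2 L → ℝ :=
  fun u => q * (harmonic (min (torusDist u y) ρ) : ℝ) - q * (harmonic (min (torusDist u x) ρ) : ℝ)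

omit [NeZero L] in
/-- **Gain of the dipole (P1).** For `2ρ + 1 ≤ dist(x,y)`: `φ_x - φ_y = 2q H(ρ)`.
Koma–Tasaki, PRL 68 (1992) 3248, proof of eq. (13), property P1 (`ℓ^∞` version).
[cite: KomaTasakiPRL1992, proof of eq. (13) (P1)] -/
theorem logDipole_gain (x y : TorusSite 2 L) (q : ℝ) (ρ : ℕ) (hρ : 2 * ρ + 1 ≤ torusDist x y) :
    logDipole x y q ρ x - logDipole x y q ρ y = 2 * q * (harmonic ρ : ℝ) := by
  have hxy : min (torusDist x y) ρ = ρ := min_eq_right (by omega)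
  have hyx : min (torusDist y x) ρ = ρ := by rw [torusDist_comm']; exact hxy
  simp only [logDipole, torusDist_self, hxy, hyx, Nat.zero_min, harmonic_zero, Rat.cast_zero,
    mul_zero]
  ring

/-- **Energy of the dipole on a finite-range graph (P2).** Under the hypotheses of
`logMonopole_energy_le_of_graph` (translation invariance, bonds of `ℓ^∞`-length `≤ 1`, outward
bond count `≤ A(s+1)`), for `2ρ + 1 ≤ dist(x,y)` the dipole `logDipole x y q ρ` has
`Σ_u Σ_v [u ∼_Γ v] (cosh(φ_u - φ_v) - 1) ≤ 2A q² e^{q²/2} H(ρ)` (a bond of length `≤ 1` meeting the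
ball of radius `ρ` about `y` misses the one about `x`: the monopole energies add). Koma–Tasaki,
PRL 68 (1992) 3248, proof of eq. (13) (P2), note 9. [cite: KomaTasakiPRL1992, proof of eq. (13) (P2) and note 9] -/
theorem logDipole_energy_le_of_graph (Γ : SimpleGraph (TorusSite 2 L)) [DecidableRel Γ.Adj]
    (A : ℕ) (hΓd : ∀ u v, Γ.Adj u v → torusDist u v ≤ 1)
    (hΓt : ∀ u v c, Γ.Adj (u - c) (v - c) ↔ Γ.Adj u v)
    (hΓc : ∀ s : ℕ, ∑ z ∈ univ.filter (fun z : TorusSite 2 L => torusNorm z = s),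
        #{w : TorusSite 2 L | Γ.Adj z w ∧ torusNorm w = s + 1} ≤ A * (s + 1))
    (x y : TorusSite 2 L) (q : ℝ) (ρ : ℕ) (hρ : 2 * ρ + 1 ≤ torusDist x y) :
    ∑ u : TorusSite 2 L, ∑ v : TorusSite 2 L,
        (if Γ.Adj u v then (Real.cosh (logDipole x y q ρ u - logDipole x y q ρ v) - 1) else 0) ≤
      2 * (A : ℝ) * (q ^ 2 * Real.exp (q ^ 2 / 2)) * (harmonic ρ : ℝ) := by
  classical
  set a : TorusSite 2 L → ℝ := fun u => q * (harmonic (min (torusDist u y) ρ) : ℝ) with ha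
  set b : TorusSite 2 L → ℝ := fun u => q * (harmonic (min (torusDist u x) ρ) : ℝ) with hb
  have hφ : ∀ u, logDipole x y q ρ u = a u - b u := fun u => rfl
  -- bondwise splitting
  have hsplit : ∀ u v, Γ.Adj u v →
      Real.cosh ((a u - b u) - (a v - b v)) - 1 =
        (Real.cosh (a u - a v) - 1) + (Real.cosh (b u - b v) - 1) := by
    intro u v huv
    have hre : (a u - b u) - (a v - b v) = (a u - a v) - (b u - b v) := by ring
    rw [hre]
    by_cases hyc : min (torusDist u y) ρ = min (torusDist v y) ρ
    · have hA0 : a u - a v = 0 := by simp only [ha, hyc, sub_self]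
      rw [hA0, zero_sub, Real.cosh_neg, Real.cosh_zero, sub_self, zero_add]
    · -- the bond meets the ball of radius `ρ` about `y`, hence not the one about `x`
      have hlip := min_torusDist_le_of_torusDist_le_one (hΓd u v huv) y ρ
      have huy : torusDist u y ≤ ρ := by omega
      have hvy : torusDist v y ≤ ρ := by omega
      have htu := torusDist_triangle' x u y
      have htv := torusDist_triangle' x v y
      rw [torusDist_comm' x u] at htu
      rw [torusDist_comm' x v] at htv
      have hux : min (torusDist u x) ρ = ρ := min_eq_right (by omega)
      have hvx : min (torusDist v x) ρ = ρ := min_eq_right (by omega)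
      have hB0 : b u - b v = 0 := by simp only [hb, hux, hvx, sub_self]
      rw [hB0, sub_zero, Real.cosh_zero, sub_self, add_zero]
  have hmonoY := logMonopole_energy_le_of_graph Γ A hΓd hΓt hΓc y ρ q
  have hmonoX := logMonopole_energy_le_of_graph Γ A hΓd hΓt hΓc x ρ q
  calc ∑ u : TorusSite 2 L, ∑ v : TorusSite 2 L,
        (if Γ.Adj u v then (Real.cosh (logDipole x y q ρ u - logDipole x y q ρ v) - 1) else 0)
      = ∑ u : TorusSite 2 L, ∑ v : TorusSite 2 L,
          ((if Γ.Adj u v then (Real.cosh (a u - a v) - 1) else 0) +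
            (if Γ.Adj u v then (Real.cosh (b u - b v) - 1) else 0)) := by
        refine sum_congr rfl fun u _ => sum_congr rfl fun v _ => ?_
        split_ifs with huv
        · rw [hφ, hφ]; exact hsplit u v huv
        · simp
    _ = (∑ u : TorusSite 2 L, ∑ v : TorusSite 2 L,
          (if Γ.Adj u v then (Real.cosh (a u - a v) - 1) else 0)) +
        ∑ u : TorusSite 2 L, ∑ v : TorusSite 2 L,
          (if Γ.Adj u v then (Real.cosh (b u - b v) - 1) else 0) := by
        simp only [sum_add_distrib]
    _ ≤ (A : ℝ) * (q ^ 2 * Real.exp (q ^ 2 / 2)) * (harmonic ρ : ℝ) +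
        (A : ℝ) * (q ^ 2 * Real.exp (q ^ 2 / 2)) * (harmonic ρ : ℝ) := add_le_add hmonoY hmonoX
    _ = 2 * (A : ℝ) * (q ^ 2 * Real.exp (q ^ 2 / 2)) * (harmonic ρ : ℝ) := by ring

/-! ### The nearest-neighbour torus graph: `A = 8` -/

/-- The nearest-neighbour torus graph satisfies the three hypotheses with `A = 8`
(`sum_card_outward_le`: `N_s ≤ 8s + 4 ≤ 8(s+1)`), so the dipole has nearest-neighbour energy
`≤ 16 q² e^{q²/2} H(ρ)` (this is `TorusLogDipole.exists_logDipole` for the explicit `logDipole`).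
Koma–Tasaki, PRL 68 (1992) 3248, proof of eq. (13) (P2). [cite: KomaTasakiPRL1992, proof of eq. (13) (P2)] -/
theorem logDipole_energy_torusGraph_le (x y : TorusSite 2 L) (q : ℝ) (ρ : ℕ)
    (hρ : 2 * ρ + 1 ≤ torusDist x y) :
    ∑ u : TorusSite 2 L, ∑ v : TorusSite 2 L,
        (if (torusGraph 2 L).Adj u v then
          (Real.cosh (logDipole x y q ρ u - logDipole x y q ρ v) - 1) else 0) ≤
      16 * (q ^ 2 * Real.exp (q ^ 2 / 2)) * (harmonic ρ : ℝ) := by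
  have h := logDipole_energy_le_of_graph (torusGraph 2 L) 8
    (fun u v huv => torusDist_le_one_of_adj huv)
    (fun u v c => torusGraph_adj_sub_right_iff u v c)
    (fun s => (sum_card_outward_le s).trans (by omega)) x y q ρ hρ
  calc _ ≤ 2 * ((8 : ℕ) : ℝ) * (q ^ 2 * Real.exp (q ^ 2 / 2)) * (harmonic ρ : ℝ) := h
    _ = 16 * (q ^ 2 * Real.exp (q ^ 2 / 2)) * (harmonic ρ : ℝ) := by norm_num

end Literature.MathematicalPhysics.QuantumLattice
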